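import Mathlib
import Literature.Analysis.FluidPDE.GaussianVortexPlanar
import Literature.Analysis.FluidPDE.GaussianVortexPlanarProofs
import Literature.Analysis.FluidPDE.BiotSavart2DSymmetry
import Literature.Analysis.FluidPDE.PlanarBiotSavartDivFree
import Summits.AnomalousDissipation.AnomalousDissipation.Theorems.MarginalStabilityChainStretchedVortexRowsStubLogPotentialTools
import HarnessLib

/-!
# Helper `logPotential_gradient_eq` toward stub `stub_coreInverse` of the line
# `braid-closed-large-circulation-gluing` (crux stmt-AnomalousDissipation-3009, `MarginalStabilityChain.StretchedVortexRows`)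

The gradient of the logarithmic potential `ψ = N ∗ g`, `N = (2π)⁻¹ log ‖·‖`, of a `C¹` Gaussian-class density on
`ℝ² = EuclideanSpace ℝ (Fin 2)` (wave 3, toward `logPotential_neutral_energy`): starting from the derivative-on-`g` formula
`Dψ(ξ)[v] = ∫ N(ξ − η) Dg(η)[v] dη` of the toolkit file, ONE SINGULAR INTEGRATION BY PARTS moves the derivative onto the
kernel, `∇ψ(ξ) = ∫ g(η) DN(ξ − η) dη` with `DN(z) = (2π‖z‖²)⁻¹ z ∈ L¹_loc`:

* the regularised kernel `N_ε(z) = (4π)⁻¹ log(‖z‖² + ε²)` is smooth, `DN_ε(z) = (2π)⁻¹ z/(‖z‖² + ε²)`, `|DN_ε| ≤ |DN|`,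
  `|N_ε| ≤ 2|N| + (4π)⁻¹‖z‖²` off the origin (`0 < ε ≤ 1`); `∫ N_ε(ξ − η) ∂_v g(η) dη = ∫ ⟪DN_ε(ξ − η), v⟫ g(η) dη`
  (whole-plane integration by parts, all products Gaussian-integrable); `ε → 0` on both sides by dominated convergence.
-/

set_option linter.dupNamespace false
noncomputable section
open scoped RealInnerProductSpace Topology
open MeasureTheory WithLp Function Metric Filter Set

namespace Summit.AnomalousDissipation.AnomalousDissipation.Theorems.MarginalStabilityChainStretchedVortexRows

open Literature.Analysis.FluidPDE

/-! ### The regularised logarithmic kernel `N_ε(z) = (4π)⁻¹ log(‖z‖² + ε²)` -/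

section RegLog
variable {ε : ℝ} (hε : 0 < ε)
include hε

/-- `DN_ε(z) = (2π)⁻¹ (‖z‖² + ε²)⁻¹ ⟪z, ·⟫`. [folklore] -/
theorem hasFDerivAt_logReg (z : EuclideanSpace ℝ (Fin 2)) :
    HasFDerivAt (fun w : EuclideanSpace ℝ (Fin 2) => (4 * Real.pi)⁻¹ * Real.log (‖w‖ ^ 2 + ε ^ 2))
      (((2 * Real.pi)⁻¹ * (‖z‖ ^ 2 + ε ^ 2)⁻¹) • innerSL ℝ z) z := by
  have hpos : 0 < ‖z‖ ^ 2 + ε ^ 2 := by positivity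
  have h := ((hasFDerivAt_normSq_add_sq (ε := ε) z).log hpos.ne').const_mul (4 * Real.pi)⁻¹
  refine h.congr_fderiv ?_
  ext v
  simp only [FunLike.coe_smul, Pi.smul_apply, smul_eq_mul, innerSL_apply_apply]
  ring

/-- `∂_v [η ↦ N_ε(ξ − η)] = −(2π)⁻¹ ⟪ξ − η, v⟫ / (‖ξ − η‖² + ε²)`. [folklore] -/
theorem fderiv_logReg_sub (ξ η v : EuclideanSpace ℝ (Fin 2)) :
    fderiv ℝ (fun η : EuclideanSpace ℝ (Fin 2) => (4 * Real.pi)⁻¹ * Real.log (‖ξ - η‖ ^ 2 + ε ^ 2)) η v =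
      -((2 * Real.pi)⁻¹ * ⟪ξ - η, v⟫ / (‖ξ - η‖ ^ 2 + ε ^ 2)) := by
  have h : HasFDerivAt (fun η : EuclideanSpace ℝ (Fin 2) => (4 * Real.pi)⁻¹ * Real.log (‖ξ - η‖ ^ 2 + ε ^ 2))
      ((((2 * Real.pi)⁻¹ * (‖ξ - η‖ ^ 2 + ε ^ 2)⁻¹) • innerSL ℝ (ξ - η)).comp
        (-(ContinuousLinearMap.id ℝ (EuclideanSpace ℝ (Fin 2))))) η :=
    (hasFDerivAt_logReg hε (ξ - η)).comp η ((hasFDerivAt_id η).const_sub ξ)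
  rw [h.fderiv]
  simp only [ContinuousLinearMap.comp_apply, neg_apply, ContinuousLinearMap.id_apply,
    map_neg, FunLike.coe_smul, Pi.smul_apply, smul_eq_mul, innerSL_apply_apply]
  ring

/-- `η ↦ N_ε(ξ − η)` is differentiable. [folklore] -/
theorem differentiable_logReg_sub (ξ : EuclideanSpace ℝ (Fin 2)) :
    Differentiable ℝ fun η : EuclideanSpace ℝ (Fin 2) => (4 * Real.pi)⁻¹ * Real.log (‖ξ - η‖ ^ 2 + ε ^ 2) :=
  fun η => ((hasFDerivAt_logReg hε (ξ - η)).comp η ((hasFDerivAt_id η).const_sub ξ)).differentiableAt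

/-- `|log(‖z‖² + ε²)| ≤ |log ε²| + ‖z‖²/ε²`. [folklore] -/
theorem abs_log_normSq_add_sq_le (z : EuclideanSpace ℝ (Fin 2)) :
    |Real.log (‖z‖ ^ 2 + ε ^ 2)| ≤ |Real.log (ε ^ 2)| + ‖z‖ ^ 2 / ε ^ 2 := by
  have hε2 : 0 < ε ^ 2 := by positivity
  have h1 : Real.log (ε ^ 2) ≤ Real.log (‖z‖ ^ 2 + ε ^ 2) :=
    Real.log_le_log hε2 (by nlinarith [sq_nonneg ‖z‖])
  have h2 : Real.log (‖z‖ ^ 2 + ε ^ 2) ≤ Real.log (ε ^ 2) + ‖z‖ ^ 2 / ε ^ 2 := by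
    have he : ‖z‖ ^ 2 + ε ^ 2 = ε ^ 2 * (1 + ‖z‖ ^ 2 / ε ^ 2) := by field_simp; ring
    rw [he, Real.log_mul hε2.ne' (by positivity)]
    have := Real.log_le_sub_one_of_pos (by positivity : (0:ℝ) < 1 + ‖z‖ ^ 2 / ε ^ 2)
    linarith
  have h3 : 0 ≤ ‖z‖ ^ 2 / ε ^ 2 := by positivity
  rw [abs_le]
  constructor
  · linarith [neg_abs_le (Real.log (ε ^ 2))]
  · linarith [le_abs_self (Real.log (ε ^ 2))]

end RegLog

/-- `|⟪z, v⟫| / (‖z‖² + ε²) ≤ ‖v‖ ‖z‖⁻¹` (also `ε = 0`, with `0⁻¹ = 0`). [folklore] -/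
theorem abs_inner_div_normSq_add_sq_le (ε : ℝ) (z v : EuclideanSpace ℝ (Fin 2)) :
    |⟪z, v⟫ / (‖z‖ ^ 2 + ε ^ 2)| ≤ ‖v‖ * ‖z‖⁻¹ := by
  rcases eq_or_ne z 0 with rfl | hz
  · simp
  have hn : 0 < ‖z‖ := norm_pos_iff.2 hz
  have hpos : 0 < ‖z‖ ^ 2 + ε ^ 2 := by positivity
  rw [abs_div, abs_of_pos hpos, div_le_iff₀ hpos]
  calc |⟪z, v⟫| ≤ ‖z‖ * ‖v‖ := abs_real_inner_le_norm z v
    _ = ‖v‖ * ‖z‖⁻¹ * ‖z‖ ^ 2 := by field_simp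
    _ ≤ ‖v‖ * ‖z‖⁻¹ * (‖z‖ ^ 2 + ε ^ 2) := by gcongr; nlinarith [sq_nonneg ε]

/-- For `0 < ε ≤ 1` and `z ≠ 0`: `|log(‖z‖² + ε²)| ≤ 2 |log ‖z‖| + ‖z‖²` (uniform in `ε`). [folklore] -/
theorem abs_log_normSq_add_sq_le_unif {ε : ℝ} (hε : 0 < ε) (hε1 : ε ≤ 1) {z : EuclideanSpace ℝ (Fin 2)}
    (hz : z ≠ 0) : |Real.log (‖z‖ ^ 2 + ε ^ 2)| ≤ 2 * |Real.log ‖z‖| + ‖z‖ ^ 2 := by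
  have hn : 0 < ‖z‖ := norm_pos_iff.2 hz
  have h0 : 0 ≤ |Real.log ‖z‖| := abs_nonneg _
  by_cases h : 1 ≤ ‖z‖ ^ 2 + ε ^ 2
  · rw [abs_of_nonneg (Real.log_nonneg h)]
    have := Real.log_le_sub_one_of_pos (by positivity : 0 < ‖z‖ ^ 2 + ε ^ 2)
    nlinarith
  · rw [not_le] at h
    have hneg : Real.log (‖z‖ ^ 2 + ε ^ 2) < 0 := Real.log_neg (by positivity) h
    rw [abs_of_neg hneg]
    have h1 : Real.log (‖z‖ ^ 2) ≤ Real.log (‖z‖ ^ 2 + ε ^ 2) :=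
      Real.log_le_log (by positivity) (by nlinarith [sq_nonneg ε])
    rw [Real.log_pow, Nat.cast_ofNat] at h1
    have h2 : Real.log ‖z‖ ≤ 0 := Real.log_nonpos hn.le (by nlinarith [sq_nonneg ε])
    rw [abs_of_nonpos h2]
    nlinarith [sq_nonneg ‖z‖]

/-! ### Integrability against Gaussian-bounded densities -/
/-- `‖ξ − η‖⁻¹ e^{−‖η‖²/8}` is integrable in `η` (`‖z‖⁻¹ ≤ 𝟙_{‖z‖<1}‖z‖⁻¹ + 1`). [folklore] -/
theorem integrable_inv_norm_sub_mul_exp (ξ : EuclideanSpace ℝ (Fin 2)) :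
    Integrable fun η : EuclideanSpace ℝ (Fin 2) => ‖ξ - η‖⁻¹ * Real.exp (-(1 / 8) * ‖η‖ ^ 2) := by
  have h1 : Integrable fun η : EuclideanSpace ℝ (Fin 2) =>
      (ball (0 : EuclideanSpace ℝ (Fin 2)) 1).indicator (fun z => ‖z‖⁻¹) (ξ - η) :=
    integrable_indicator_inv_norm.comp_sub_left ξ
  have h2 := integrable_one_add_norm_pow_mul_exp_eighth 0
  simp only [pow_zero, one_mul] at h2
  refine (h1.add h2).mono' ?_ (Eventually.of_forall fun η => ?_)
  · exact ((measurable_norm.comp (measurable_const.sub measurable_id)).inv.mul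
      (by fun_prop : Measurable fun η : EuclideanSpace ℝ (Fin 2) => Real.exp (-(1 / 8) * ‖η‖ ^ 2))).aestronglyMeasurable
  rw [Real.norm_of_nonneg (by positivity), Pi.add_apply]
  have he : Real.exp (-(1 / 8) * ‖η‖ ^ 2) ≤ 1 := Real.exp_le_one_iff.2 (by nlinarith [norm_nonneg η])
  have he0 : 0 ≤ Real.exp (-(1 / 8) * ‖η‖ ^ 2) := (Real.exp_pos _).le
  by_cases hb : ξ - η ∈ ball (0 : EuclideanSpace ℝ (Fin 2)) 1
  · rw [indicator_of_mem hb]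
    nlinarith [inv_nonneg.2 (norm_nonneg (ξ - η))]
  · rw [indicator_of_notMem hb, zero_add]
    have h3 : ‖ξ - η‖⁻¹ ≤ 1 := inv_le_one_of_one_le₀ (by simpa [mem_ball_zero_iff] using hb)
    nlinarith [inv_nonneg.2 (norm_nonneg (ξ - η))]

section Density

variable {B : ℝ} {h : EuclideanSpace ℝ (Fin 2) → ℝ} (hh : Continuous h)
  (hb : ∀ η, |h η| ≤ B * Real.exp (-(1 / 8) * ‖η‖ ^ 2))
include hh hb

/-- `N_ε(ξ − ·) h` is integrable for a continuous Gaussian-bounded `h`. [folklore] -/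
theorem integrable_logReg_mul {ε : ℝ} (hε : 0 < ε) (ξ : EuclideanSpace ℝ (Fin 2)) :
    Integrable fun η : EuclideanSpace ℝ (Fin 2) => (4 * Real.pi)⁻¹ * Real.log (‖ξ - η‖ ^ 2 + ε ^ 2) * h η := by
  have hB : 0 ≤ B := (abs_nonneg _).trans ((hb 0).trans (le_of_eq (by simp)))
  set c : ℝ := |Real.log (ε ^ 2)| + 2 * ‖ξ‖ ^ 2 / ε ^ 2 + 2 / ε ^ 2 with hc
  have hc0 : 0 ≤ c := by positivity
  refine (((integrable_one_add_norm_pow_mul_exp_eighth 2).const_mul ((4 * Real.pi)⁻¹ * c * B))).mono' ?_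
    (Eventually.of_forall fun η => ?_)
  · exact ((((differentiable_logReg_sub hε ξ).continuous)).mul hh).aestronglyMeasurable
  rw [Real.norm_eq_abs, abs_mul, abs_mul, abs_of_pos (by positivity : (0:ℝ) < (4 * Real.pi)⁻¹)]
  have h1 := abs_log_normSq_add_sq_le hε (ξ - η)
  have h2 : ‖ξ - η‖ ^ 2 ≤ 2 * ‖ξ‖ ^ 2 + 2 * ‖η‖ ^ 2 := by
    have ha : ‖ξ - η‖ ^ 2 ≤ (‖ξ‖ + ‖η‖) ^ 2 := pow_le_pow_left₀ (norm_nonneg _) (norm_sub_le ξ η) 2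
    nlinarith [sq_nonneg (‖ξ‖ - ‖η‖)]
  have h3 : |Real.log (‖ξ - η‖ ^ 2 + ε ^ 2)| ≤ c * (1 + ‖η‖) ^ 2 := by
    have hε2 : 0 < ε ^ 2 := by positivity
    calc |Real.log (‖ξ - η‖ ^ 2 + ε ^ 2)| ≤ |Real.log (ε ^ 2)| + (2 * ‖ξ‖ ^ 2 + 2 * ‖η‖ ^ 2) / ε ^ 2 := by
          refine h1.trans ?_; gcongr
      _ = (|Real.log (ε ^ 2)| + 2 * ‖ξ‖ ^ 2 / ε ^ 2) * 1 + 2 / ε ^ 2 * ‖η‖ ^ 2 := by field_simp; ring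
      _ ≤ (|Real.log (ε ^ 2)| + 2 * ‖ξ‖ ^ 2 / ε ^ 2) * (1 + ‖η‖) ^ 2 + 2 / ε ^ 2 * (1 + ‖η‖) ^ 2 := by
          gcongr <;> nlinarith [norm_nonneg η]
      _ = c * (1 + ‖η‖) ^ 2 := by simp only [hc]; ring
  calc (4 * Real.pi)⁻¹ * |Real.log (‖ξ - η‖ ^ 2 + ε ^ 2)| * |h η|
      ≤ (4 * Real.pi)⁻¹ * (c * (1 + ‖η‖) ^ 2) * (B * Real.exp (-(1 / 8) * ‖η‖ ^ 2)) := by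
        gcongr; exact hb η
    _ = _ := by ring

/-- `DN_ε(ξ − ·)[v] h` is integrable. [folklore] -/
theorem integrable_kernelReg_mul {ε : ℝ} (hε : 0 < ε) (ξ v : EuclideanSpace ℝ (Fin 2)) :
    Integrable fun η : EuclideanSpace ℝ (Fin 2) =>
      (2 * Real.pi)⁻¹ * ⟪ξ - η, v⟫ / (‖ξ - η‖ ^ 2 + ε ^ 2) * h η := by
  have hB : 0 ≤ B := (abs_nonneg _).trans ((hb 0).trans (le_of_eq (by simp)))
  refine ((integrable_inv_norm_sub_mul_exp ξ).const_mul ((2 * Real.pi)⁻¹ * ‖v‖ * B)).mono' ?_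
    (Eventually.of_forall fun η => ?_)
  · refine (Continuous.mul ?_ hh).aestronglyMeasurable
    refine Continuous.div (continuous_const.mul ((continuous_const.sub continuous_id).inner continuous_const))
      (by fun_prop) fun η => ?_
    have : 0 < ‖ξ - η‖ ^ 2 + ε ^ 2 := by positivity
    exact this.ne'
  rw [Real.norm_eq_abs, abs_mul, mul_div_assoc, abs_mul, abs_of_pos (by positivity : (0:ℝ) < (2 * Real.pi)⁻¹)]
  have h1 := abs_inner_div_normSq_add_sq_le ε (ξ - η) v
  calc (2 * Real.pi)⁻¹ * |⟪ξ - η, v⟫ / (‖ξ - η‖ ^ 2 + ε ^ 2)| * |h η|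
      ≤ (2 * Real.pi)⁻¹ * (‖v‖ * ‖ξ - η‖⁻¹) * (B * Real.exp (-(1 / 8) * ‖η‖ ^ 2)) := by gcongr; exact hb η
    _ = _ := by ring

/-- `DN(ξ − ·)[v] h = (2π)⁻¹ ⟪ξ − η, v⟫ ‖ξ − η‖⁻² h(η)` is integrable (`|·| ≤ (2π)⁻¹ ‖v‖ ‖ξ − η‖⁻¹ B e^{−‖η‖²/8}`). [folklore] -/
theorem integrable_kernel_mul (ξ v : EuclideanSpace ℝ (Fin 2)) :
    Integrable fun η : EuclideanSpace ℝ (Fin 2) => (2 * Real.pi)⁻¹ * ⟪ξ - η, v⟫ / ‖ξ - η‖ ^ 2 * h η := by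
  have hB : 0 ≤ B := (abs_nonneg _).trans ((hb 0).trans (le_of_eq (by simp)))
  refine ((integrable_inv_norm_sub_mul_exp ξ).const_mul ((2 * Real.pi)⁻¹ * ‖v‖ * B)).mono' ?_
    (Eventually.of_forall fun η => ?_)
  · exact ((((measurable_const.mul ((measurable_const.sub measurable_id).inner measurable_const)).div
      ((measurable_norm.comp (measurable_const.sub measurable_id)).pow_const 2))).mul
      hh.measurable).aestronglyMeasurable
  rw [Real.norm_eq_abs, abs_mul, mul_div_assoc, abs_mul, abs_of_pos (by positivity : (0:ℝ) < (2 * Real.pi)⁻¹)]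
  have h1 := abs_inner_div_normSq_add_sq_le 0 (ξ - η) v
  simp only [ne_eq, OfNat.ofNat_ne_zero, not_false_eq_true, zero_pow, add_zero] at h1
  calc (2 * Real.pi)⁻¹ * |⟪ξ - η, v⟫ / ‖ξ - η‖ ^ 2| * |h η|
      ≤ (2 * Real.pi)⁻¹ * (‖v‖ * ‖ξ - η‖⁻¹) * (B * Real.exp (-(1 / 8) * ‖η‖ ^ 2)) := by gcongr; exact hb η
    _ = _ := by ring

end Density

/-! ### Integration by parts against the regularised kernel, and the limit `ε → 0` -/

section IBP
variable {B : ℝ} {f : EuclideanSpace ℝ (Fin 2) → ℝ} (hf : ContDiff ℝ 1 f)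
  (hf0 : ∀ η, |f η| ≤ B * Real.exp (-(1 / 8) * ‖η‖ ^ 2))
  (hf1 : ∀ η, ‖fderiv ℝ f η‖ ≤ B * Real.exp (-(1 / 8) * ‖η‖ ^ 2))
include hf hf0 hf1

omit hf0 in
/-- The directional derivative `∂_v f` is continuous with the Gaussian bound `B ‖v‖ e^{−‖η‖²/8}`. [folklore] -/
theorem continuous_and_bound_fderiv_apply (v : EuclideanSpace ℝ (Fin 2)) :
    Continuous (fun η => fderiv ℝ f η v) ∧
      ∀ η, |fderiv ℝ f η v| ≤ B * ‖v‖ * Real.exp (-(1 / 8) * ‖η‖ ^ 2) := by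
  refine ⟨(hf.continuous_fderiv one_ne_zero).clm_apply continuous_const, fun η => ?_⟩
  calc |fderiv ℝ f η v| = ‖fderiv ℝ f η v‖ := (Real.norm_eq_abs _).symm
    _ ≤ ‖fderiv ℝ f η‖ * ‖v‖ := ContinuousLinearMap.le_opNorm _ _
    _ ≤ B * Real.exp (-(1 / 8) * ‖η‖ ^ 2) * ‖v‖ := by gcongr; exact hf1 η
    _ = _ := by ring

/-- **Regularised integration by parts**: `∫ N_ε(ξ − η) ∂_v f(η) dη = ∫ (2π)⁻¹ ⟪ξ−η, v⟫ (‖ξ−η‖² + ε²)⁻¹ f(η) dη`. [folklore] -/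
theorem integral_logReg_mul_fderiv {ε : ℝ} (hε : 0 < ε) (ξ v : EuclideanSpace ℝ (Fin 2)) :
    ∫ η, (4 * Real.pi)⁻¹ * Real.log (‖ξ - η‖ ^ 2 + ε ^ 2) * fderiv ℝ f η v =
      ∫ η, (2 * Real.pi)⁻¹ * ⟪ξ - η, v⟫ / (‖ξ - η‖ ^ 2 + ε ^ 2) * f η := by
  obtain ⟨hcv, hbv⟩ := continuous_and_bound_fderiv_apply hf hf1 v
  have h1 : Integrable fun η : EuclideanSpace ℝ (Fin 2) =>
      fderiv ℝ (fun η : EuclideanSpace ℝ (Fin 2) => (4 * Real.pi)⁻¹ * Real.log (‖ξ - η‖ ^ 2 + ε ^ 2)) η v * f η := by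
    have := (integrable_kernelReg_mul hf.continuous hf0 hε ξ v).neg
    refine this.congr (Eventually.of_forall fun η => ?_)
    simp only [Pi.neg_apply]
    rw [fderiv_logReg_sub hε]
    ring
  have h := integral_mul_fderiv_eq_neg_fderiv_mul_of_integrable (μ := volume) h1
    (integrable_logReg_mul hcv hbv hε ξ) (integrable_logReg_mul hf.continuous hf0 hε ξ)
    (fun η _ => differentiable_logReg_sub hε ξ η) (fun η _ => hf.differentiable one_ne_zero η)
  rw [h, ← integral_neg]
  refine integral_congr_ae (Eventually.of_forall fun η => ?_)
  beta_reduce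
  rw [fderiv_logReg_sub hε]
  ring

/-- **The singular integration by parts** `∫ N(ξ − η) ∂_v f(η) dη = ∫ ⟪DN(ξ − η), v⟫ f(η) dη`,
`N = (2π)⁻¹ log ‖·‖`, `DN(z) = (2π)⁻¹ z/‖z‖²` (limit `ε → 0` of the regularised identity by dominated
convergence on both sides: `|N_ε| ≤ 2|N| + (4π)⁻¹‖z‖²` off the origin, `|DN_ε| ≤ |DN| ∈ L¹_loc`). [folklore] -/
theorem integral_logKernel_mul_fderiv_eq (ξ v : EuclideanSpace ℝ (Fin 2)) :
    ∫ η, (2 * Real.pi)⁻¹ * Real.log ‖ξ - η‖ * fderiv ℝ f η v =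
      ∫ η, (2 * Real.pi)⁻¹ * ⟪ξ - η, v⟫ / ‖ξ - η‖ ^ 2 * f η := by
  have hB : 0 ≤ B := (abs_nonneg _).trans ((hf0 0).trans (le_of_eq (by simp)))
  obtain ⟨hcv, hbv⟩ := continuous_and_bound_fderiv_apply hf hf1 v
  have hεn : ∀ n : ℕ, (0:ℝ) < ((n:ℝ) + 1)⁻¹ := fun n => by positivity
  have hεn1 : ∀ n : ℕ, ((n:ℝ) + 1)⁻¹ ≤ 1 := fun n => inv_le_one_of_one_le₀ (by linarith [n.cast_nonneg (α := ℝ)])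
  have h0 : Tendsto (fun n : ℕ => ((n:ℝ) + 1)⁻¹) atTop (𝓝 0) := by
    simpa [one_div] using tendsto_one_div_add_atTop_nhds_zero_nat (𝕜 := ℝ)
  have hae : ∀ᵐ η ∂(volume : Measure (EuclideanSpace ℝ (Fin 2))), η ≠ ξ := by
    rw [ae_iff]
    simp
  -- the left-hand sides converge
  have hL : Tendsto (fun n : ℕ => ∫ η, (4 * Real.pi)⁻¹ * Real.log (‖ξ - η‖ ^ 2 + (((n:ℝ) + 1)⁻¹) ^ 2) *
      fderiv ℝ f η v) atTop (𝓝 (∫ η, (2 * Real.pi)⁻¹ * Real.log ‖ξ - η‖ * fderiv ℝ f η v)) := by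
    set cξ : ℝ := Real.log (1 + ‖ξ‖) + ‖ξ‖ ^ 2 with hcξ
    have hcξ0 : 0 ≤ cξ := add_nonneg (Real.log_nonneg (by linarith [norm_nonneg ξ])) (sq_nonneg _)
    have hi0 : Integrable fun η : EuclideanSpace ℝ (Fin 2) =>
        (ball (0 : EuclideanSpace ℝ (Fin 2)) 1).indicator (fun z => -Real.log ‖z‖) (ξ - η) :=
      integrable_indicator_neg_log_norm.comp_sub_left ξ
    have hi2 := integrable_one_add_norm_pow_mul_exp_eighth 2
    refine tendsto_integral_of_dominated_convergence
      (fun η => (4 * Real.pi)⁻¹ * (2 * (B * ‖v‖)) *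
        ((ball (0 : EuclideanSpace ℝ (Fin 2)) 1).indicator (fun z => -Real.log ‖z‖) (ξ - η) +
          (cξ + 1) * ((1 + ‖η‖) ^ 2 * Real.exp (-(1 / 8) * ‖η‖ ^ 2))))
      (fun n => ?_) ((hi0.add (hi2.const_mul _)).const_mul _) (fun n => ?_) ?_
    · exact (((differentiable_logReg_sub (hεn n) ξ).continuous).mul hcv).aestronglyMeasurable
    · filter_upwards [hae] with η hη
      have hz : ξ - η ≠ 0 := sub_ne_zero.2 (Ne.symm hη)
      rw [Real.norm_eq_abs, abs_mul, abs_mul, abs_of_pos (by positivity : (0:ℝ) < (4 * Real.pi)⁻¹)]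
      have h1 := abs_log_normSq_add_sq_le_unif (hεn n) (hεn1 n) hz
      have h2 := abs_log_norm_sub_le ξ η
      have h3 : ‖ξ - η‖ ^ 2 ≤ 2 * ‖ξ‖ ^ 2 + 2 * ‖η‖ ^ 2 := by
        have ha : ‖ξ - η‖ ^ 2 ≤ (‖ξ‖ + ‖η‖) ^ 2 := pow_le_pow_left₀ (norm_nonneg _) (norm_sub_le ξ η) 2
        nlinarith [sq_nonneg (‖ξ‖ - ‖η‖)]
      have h4 := indicator_neg_log_norm_nonneg (ξ - η)
      have he : Real.exp (-(1 / 8) * ‖η‖ ^ 2) ≤ 1 := Real.exp_le_one_iff.2 (by nlinarith [norm_nonneg η])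
      have he0 : 0 ≤ Real.exp (-(1 / 8) * ‖η‖ ^ 2) := (Real.exp_pos _).le
      set L0 := (ball (0 : EuclideanSpace ℝ (Fin 2)) 1).indicator (fun z => -Real.log ‖z‖) (ξ - η) with hL0
      set e := Real.exp (-(1 / 8) * ‖η‖ ^ 2) with he'
      have h5 : 2 * |Real.log ‖ξ - η‖| + ‖ξ - η‖ ^ 2 ≤ 2 * L0 + 2 * (cξ + 1) * (1 + ‖η‖) ^ 2 := by
        have : Real.log (1 + ‖ξ‖) ≤ cξ := by simp only [hcξ]; nlinarith [norm_nonneg ξ]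
        nlinarith [norm_nonneg η, norm_nonneg ξ]
      calc (4 * Real.pi)⁻¹ * |Real.log (‖ξ - η‖ ^ 2 + (((n:ℝ) + 1)⁻¹) ^ 2)| * |fderiv ℝ f η v|
          ≤ (4 * Real.pi)⁻¹ * (2 * L0 + 2 * (cξ + 1) * (1 + ‖η‖) ^ 2) * (B * ‖v‖ * e) := by
            gcongr
            · exact h1.trans h5
            · exact hbv η
        _ = (4 * Real.pi)⁻¹ * (2 * (B * ‖v‖)) * (L0 * e + (cξ + 1) * ((1 + ‖η‖) ^ 2 * e)) := by ring
        _ ≤ (4 * Real.pi)⁻¹ * (2 * (B * ‖v‖)) * (L0 + (cξ + 1) * ((1 + ‖η‖) ^ 2 * e)) := by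
            gcongr; exact mul_le_of_le_one_right h4 he
    · filter_upwards [hae] with η hη
      have hz : ξ - η ≠ 0 := sub_ne_zero.2 (Ne.symm hη)
      have hn2 : (0:ℝ) < ‖ξ - η‖ ^ 2 := by positivity
      have hlim : Tendsto (fun n : ℕ => ‖ξ - η‖ ^ 2 + (((n:ℝ) + 1)⁻¹) ^ 2) atTop (𝓝 (‖ξ - η‖ ^ 2)) := by
        have := (h0.pow 2).const_add (‖ξ - η‖ ^ 2)
        rwa [zero_pow two_ne_zero, add_zero] at this
      have hlog := ((Real.continuousAt_log hn2.ne').tendsto.comp hlim).const_mul (4 * Real.pi)⁻¹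
      have he : (4 * Real.pi)⁻¹ * Real.log (‖ξ - η‖ ^ 2) = (2 * Real.pi)⁻¹ * Real.log ‖ξ - η‖ := by
        rw [Real.log_pow, Nat.cast_ofNat]; ring
      rw [he] at hlog
      exact hlog.mul_const _
  -- the right-hand sides converge
  have hR : Tendsto (fun n : ℕ => ∫ η, (2 * Real.pi)⁻¹ * ⟪ξ - η, v⟫ / (‖ξ - η‖ ^ 2 + (((n:ℝ) + 1)⁻¹) ^ 2) * f η)
      atTop (𝓝 (∫ η, (2 * Real.pi)⁻¹ * ⟪ξ - η, v⟫ / ‖ξ - η‖ ^ 2 * f η)) := by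
    refine tendsto_integral_of_dominated_convergence
      (fun η => (2 * Real.pi)⁻¹ * ‖v‖ * B * (‖ξ - η‖⁻¹ * Real.exp (-(1 / 8) * ‖η‖ ^ 2)))
      (fun n => (integrable_kernelReg_mul hf.continuous hf0 (hεn n) ξ v).aestronglyMeasurable)
      ((integrable_inv_norm_sub_mul_exp ξ).const_mul _) (fun n => Eventually.of_forall fun η => ?_)
      (Eventually.of_forall fun η => ?_)
    · rw [Real.norm_eq_abs, abs_mul, mul_div_assoc, abs_mul,
        abs_of_pos (by positivity : (0:ℝ) < (2 * Real.pi)⁻¹)]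
      have h1 := abs_inner_div_normSq_add_sq_le (((n:ℝ) + 1)⁻¹) (ξ - η) v
      calc (2 * Real.pi)⁻¹ * |⟪ξ - η, v⟫ / (‖ξ - η‖ ^ 2 + (((n:ℝ) + 1)⁻¹) ^ 2)| * |f η|
          ≤ (2 * Real.pi)⁻¹ * (‖v‖ * ‖ξ - η‖⁻¹) * (B * Real.exp (-(1 / 8) * ‖η‖ ^ 2)) := by
            gcongr; exact hf0 η
        _ = _ := by ring
    · rcases eq_or_ne (ξ - η) 0 with hz | hz
      · simp only [hz, inner_zero_left, zero_div, mul_zero, zero_mul]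
        exact tendsto_const_nhds
      · have hn2 : (0:ℝ) < ‖ξ - η‖ ^ 2 := by positivity
        have hlim : Tendsto (fun n : ℕ => ‖ξ - η‖ ^ 2 + (((n:ℝ) + 1)⁻¹) ^ 2) atTop (𝓝 (‖ξ - η‖ ^ 2)) := by
          have := (h0.pow 2).const_add (‖ξ - η‖ ^ 2)
          rwa [zero_pow two_ne_zero, add_zero] at this
        exact ((hlim.inv₀ hn2.ne').const_mul ((2 * Real.pi)⁻¹ * ⟪ξ - η, v⟫)).mul_const (f η) |>.congr
          (fun n => by simp only [div_eq_mul_inv])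
  have heq : (fun n : ℕ => ∫ η, (4 * Real.pi)⁻¹ * Real.log (‖ξ - η‖ ^ 2 + (((n:ℝ) + 1)⁻¹) ^ 2) *
      fderiv ℝ f η v) =
      fun n : ℕ => ∫ η, (2 * Real.pi)⁻¹ * ⟪ξ - η, v⟫ / (‖ξ - η‖ ^ 2 + (((n:ℝ) + 1)⁻¹) ^ 2) * f η :=
    funext fun n => integral_logReg_mul_fderiv hf hf0 hf1 (hεn n) ξ v
  rw [heq] at hL
  exact tendsto_nhds_unique hL hR

end IBP

/-! ### The registered helper: the gradient of the logarithmic potential -/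
/-- The vector kernel `DN(z) = (2π‖z‖²)⁻¹ z` has norm `(2π)⁻¹ ‖z‖⁻¹` (`0` at the origin). [folklore] -/
theorem norm_gradLogKernel (z : EuclideanSpace ℝ (Fin 2)) :
    ‖(2 * Real.pi * ‖z‖ ^ 2)⁻¹ • z‖ = (2 * Real.pi)⁻¹ * ‖z‖⁻¹ := by
  rw [norm_smul, norm_inv, Real.norm_of_nonneg (by positivity)]
  rcases eq_or_ne ‖z‖ 0 with h | h
  · simp [h]
  · field_simp

/-- The Biot–Savart-type integrand `g(η) DN(ξ − η)` of a continuous Gaussian-bounded density is integrable. [folklore] -/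
theorem integrable_smul_gradLogKernel {B : ℝ} {g : EuclideanSpace ℝ (Fin 2) → ℝ} (hg : Continuous g)
    (hg0 : ∀ η, |g η| ≤ B * Real.exp (-(1 / 8) * ‖η‖ ^ 2)) (ξ : EuclideanSpace ℝ (Fin 2)) :
    Integrable fun η : EuclideanSpace ℝ (Fin 2) => g η • ((2 * Real.pi * ‖ξ - η‖ ^ 2)⁻¹ • (ξ - η)) := by
  have hB : 0 ≤ B := (abs_nonneg _).trans ((hg0 0).trans (le_of_eq (by simp)))
  refine ((integrable_inv_norm_sub_mul_exp ξ).const_mul ((2 * Real.pi)⁻¹ * B)).mono' ?_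
    (Eventually.of_forall fun η => ?_)
  · exact (hg.measurable.smul ((((measurable_const.mul ((measurable_norm.comp
      (measurable_const.sub measurable_id)).pow_const 2)).inv).smul
      (measurable_const.sub measurable_id)))).aestronglyMeasurable
  rw [norm_smul, norm_gradLogKernel, Real.norm_eq_abs]
  calc |g η| * ((2 * Real.pi)⁻¹ * ‖ξ - η‖⁻¹) ≤ B * Real.exp (-(1 / 8) * ‖η‖ ^ 2) * ((2 * Real.pi)⁻¹ * ‖ξ - η‖⁻¹) :=
        mul_le_mul_of_nonneg_right (hg0 η) (by positivity)
    _ = _ := by ring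

/-- **The gradient of the logarithmic potential** of a `C¹` Gaussian-class density:
`∇ψ(ξ) = ∫ g(η) DN(ξ − η) dη`, `DN(z) = (2π‖z‖²)⁻¹ z` (`ψ = N ∗ g`, `N = (2π)⁻¹ log ‖·‖`), the integrand being
integrable (registered helper toward `logPotential_neutral_energy` / `stub_coreInverse`). [folklore] -/
theorem logPotential_gradient_eq :
    ∀ (B : ℝ) (g : EuclideanSpace ℝ (Fin 2) → ℝ), ContDiff ℝ 1 g →
      (∀ η, |g η| ≤ B * Real.exp (-(1 / 8) * ‖η‖ ^ 2)) →
      (∀ η, ‖fderiv ℝ g η‖ ≤ B * Real.exp (-(1 / 8) * ‖η‖ ^ 2)) →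
      ∀ ξ : EuclideanSpace ℝ (Fin 2),
        Integrable (fun η : EuclideanSpace ℝ (Fin 2) => g η • ((2 * Real.pi * ‖ξ - η‖ ^ 2)⁻¹ • (ξ - η))) ∧
          gradient (fun ξ : EuclideanSpace ℝ (Fin 2) => ∫ η, (2 * Real.pi)⁻¹ * Real.log ‖ξ - η‖ * g η) ξ =
            ∫ η, g η • ((2 * Real.pi * ‖ξ - η‖ ^ 2)⁻¹ • (ξ - η)) := by
  intro B g hg hg0 hg1 ξ
  have hint := integrable_smul_gradLogKernel hg.continuous hg0 ξ
  refine ⟨hint, ?_⟩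
  obtain ⟨-, hD⟩ := logPotential_contDiff_one B g hg hg0 hg1
  refine ext_inner_left ℝ fun v => ?_
  rw [← integral_inner hint v, real_inner_comm, gradient, InnerProductSpace.toDual_symm_apply, hD ξ v,
    integral_logKernel_mul_fderiv_eq hg hg0 hg1 ξ v]
  refine integral_congr_ae (Eventually.of_forall fun η => ?_)
  simp only [real_inner_smul_right]
  rw [real_inner_comm (ξ - η) v]
  rcases eq_or_ne ‖ξ - η‖ 0 with h | h
  · simp [norm_eq_zero.1 h]
  · field_simp

end Summit.AnomalousDissipation.AnomalousDissipation.Theorems.MarginalStabilityChainStretchedVortexRows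

end
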